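import Mathlib.MeasureTheory.Measure.SeparableMeasure
import Literature.Analysis.OperatorTheory.PathKernelDomination
import Literature.Analysis.OperatorTheory.CompactSelfAdjointEigenbasis
import Literature.Analysis.OperatorTheory.JointEigenbasis
import Literature.Analysis.OperatorTheory.PositiveKernelSpectralTraceTwoSucc
import Literature.Analysis.OperatorTheory.EigenbasisCovarianceBound
import HarnessLib

/-!
# Spectral covariance bound for a NON-NEGATIVE kernel of positive type — PROVED

Topic `Literature/Analysis/OperatorTheory`; companion of `PositiveKernelTransferOperator.lean`, `PathKernelDomination.lean`,
`PositiveKernelSpectralTrace{,Two}.lean`, `EigenbasisCovarianceBound.lean`.  The transfer-matrix side of the clustering of a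
cyclic kernel chain, for a kernel that is only POINTWISE NON-NEGATIVE (not strictly positive — no Jentzsch / positivity
improving is used; written for crux `FibreAnchor`, route `QuantumFields/ContractibleFibre`, stub
`stub_traceFormulaClustering`; Mathlib + companions only, no definitions):

* `exists_forall_le_of_summable_sq`, `nonempty_index_hilbertBasis_Lp` — the eigenvalue family of the compact
  self-adjoint `L²` transfer operator attains its supremum `λ_{i₀}` (square summability);
* `kernel_spectral_cov_bound` (**main**) — on a probability space with countably generated σ-algebra, for a strongly
  measurable symmetric bounded kernel `0 ≤ K` of positive type and two bond kernels `X_a`, `X_b` dominated by the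
  `(r+1)`-step path kernel of `K`: there are eigen-data `(λᵢ)`, `i₀` with `0 ≤ λᵢ ≤ λ_{i₀}`, the vacuum trace
  formulas `∫ ∏_{Fin (m+2)} K = Σ λᵢ^{m+2}`, and — for every spectral ratio `θ` off `i₀` and every bound `R ≤ 1` on
  the normalised trace excess of the LONG arc — the covariance bound
  `|I₂/I₀ − (I₁ᵃ/I₀)(I₁ᵇ/I₀)| ≤ 2 θ^{a+2} + 6 R` for the cyclic integrals with two / one / no bond insertions
  (`HeterogeneousCyclicPeeling.integral_cyclic_insert_one/two` + `PositiveKernelSpectralTrace{,Two}` +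
  `PathKernelDomination.norm_kernelOp_le_of_abs_le_pathKernel` + `eigenbasis_cov_bound`).

References: Glimm–Jaffe 1987 §6.1; Osterwalder–Seiler 1978 §2; Reed–Simon I Thm. VI.16, VI.22–23. [folklore]
-/

set_option autoImplicit false

noncomputable section

namespace Literature.Analysis.OperatorTheory

open scoped BigOperators RealInnerProductSpace ENNReal
open _root_.MeasureTheory Filter Set Function

/-! ### A square-summable non-negative family attains its supremum -/

/-- A non-negative square-summable family on a non-empty index type attains its supremum. [folklore] -/
theorem exists_forall_le_of_summable_sq {ι : Type*} [Nonempty ι] {lam : ι → ℝ} (h0 : ∀ i, 0 ≤ lam i)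
    (hs : Summable fun i => lam i ^ 2) : ∃ i₀, ∀ i, lam i ≤ lam i₀ := by
  by_cases hex : ∃ i₁, 0 < lam i₁
  · obtain ⟨i₁, hi₁⟩ := hex
    have ht := hs.tendsto_cofinite_zero
    have hev : ∀ᶠ i in cofinite, lam i ^ 2 < lam i₁ ^ 2 := (tendsto_order.1 ht).2 _ (pow_pos hi₁ 2)
    have hfin : {i | ¬(lam i ^ 2 < lam i₁ ^ 2)}.Finite := Filter.eventually_cofinite.1 hev
    have hne : hfin.toFinset.Nonempty := ⟨i₁, by simp⟩
    obtain ⟨i₀, -, hmax⟩ := hfin.toFinset.exists_max_image lam hne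
    refine ⟨i₀, fun i => ?_⟩
    by_cases hi : lam i ^ 2 < lam i₁ ^ 2
    · have h1 : lam i < lam i₁ := lt_of_pow_lt_pow_left₀ 2 (h0 i₁) hi
      have h2 : lam i₁ ≤ lam i₀ := hmax i₁ (by simp)
      exact h1.le.trans h2
    · exact hmax i (by simpa using hi)
  · push Not at hex
    exact ⟨Classical.arbitrary ι, fun i => (hex i).trans (h0 _)⟩

/-- The index type of a Hilbert basis of `L²` of a probability space is non-empty (the constant `1` is a non-zero
vector). [folklore] -/
theorem nonempty_index_hilbertBasis_Lp {X : Type*} [MeasurableSpace X] {μ : Measure X} [IsProbabilityMeasure μ]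
    {ι : Type*} (b : HilbertBasis ι ℝ (Lp ℝ 2 μ)) : Nonempty ι := by
  by_contra h
  rw [not_nonempty_iff] at h
  set v : Lp ℝ 2 μ := indicatorConstLp 2 MeasurableSet.univ (measure_ne_top μ _) (1 : ℝ) with hv
  have hnorm : ‖v‖ = 1 := by
    rw [hv, norm_indicatorConstLp two_ne_zero ENNReal.ofNat_ne_top, norm_one, one_mul, probReal_univ,
      Real.one_rpow]
  have hsub : Subsingleton (lp (fun _ : ι => ℝ) 2) := ⟨fun a c => Subtype.ext (Subsingleton.elim _ _)⟩
  have hzero : v = 0 := b.repr.injective (Subsingleton.elim _ _)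
  rw [hzero, norm_zero] at hnorm
  exact zero_ne_one hnorm

/-! ### The spectral covariance bound -/

/-- **Spectral covariance bound for a non-negative kernel of positive type.**  On a probability space with
countably generated σ-algebra let `K` be strongly measurable, symmetric, bounded, of positive type against bounded
measurable functions, and let `X_a`, `X_b` be strongly measurable bounded bond kernels dominated by the `(r+1)`-step
path kernel of `K`.  Then there are eigen-data `(λᵢ)_{i ∈ ι}`, `i₀` of the `L²` transfer operator with
`0 ≤ λᵢ ≤ λ_{i₀}` and `∫ ∏_{t : Fin (m+2)} K(V t, V (t+1)) = Σ λᵢ^{m+2}` for all `m`, such that for all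
`θ, R ≥ 0`, `R ≤ 1`: if `0 < λ_{i₀}`, `λᵢ ≤ θ λ_{i₀}` for `i ≠ i₀`, and `Σᵢ (λᵢ/λ_{i₀})^{b'+2} ≤ 1 + R`, then the
cyclic integrals with the insertions "`X_a`, `a+2` bonds `K`, `X_b`, `b'+2` bonds `K`" (`I₂`), "`X_a` resp. `X_b`,
`r+a+b'+5` bonds `K`" (`I₁`) and the pure `K`-cycle of `2r+a+b'+6` bonds (`I₀`) satisfy
`|I₂/I₀ − (I₁ᵃ/I₀)(I₁ᵇ/I₀)| ≤ 2 θ^{a+2} + 6 R`. [folklore] -/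
theorem kernel_spectral_cov_bound {X : Type} [MeasurableSpace X] [MeasurableSpace.CountablyGenerated X]
    {μ : Measure X} [IsProbabilityMeasure μ] {K : X → X → ℝ} {C : ℝ}
    (hK : StronglyMeasurable (uncurry K)) (hC : ∀ x y, ‖K x y‖ ≤ C) (hsymm : ∀ x y, K x y = K y x)
    (hpt : ∀ f : X → ℝ, Measurable f → (∀ x, |f x| ≤ 1) → 0 ≤ ∫ x, ∫ y, f x * K x y * f y ∂μ ∂μ)
    (r : ℕ) {Xa Xb : X → X → ℝ} {CX : ℝ} (hXa : StronglyMeasurable (uncurry Xa))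
    (hXb : StronglyMeasurable (uncurry Xb)) (hCXa : ∀ u u', ‖Xa u u'‖ ≤ CX) (hCXb : ∀ u u', ‖Xb u u'‖ ≤ CX)
    (hdomA : ∀ u u' : X, |Xa u u'| ≤ 1 * (∫ v : Fin r → X, ∏ i : Fin (r + 1),
      K ((Fin.cons u (Fin.snoc v u') : Fin (r + 2) → X) (Fin.castSucc i))
        ((Fin.cons u (Fin.snoc v u') : Fin (r + 2) → X) (Fin.succ i)) ∂(Measure.pi fun _ => μ)))
    (hdomB : ∀ u u' : X, |Xb u u'| ≤ 1 * (∫ v : Fin r → X, ∏ i : Fin (r + 1),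
      K ((Fin.cons u (Fin.snoc v u') : Fin (r + 2) → X) (Fin.castSucc i))
        ((Fin.cons u (Fin.snoc v u') : Fin (r + 2) → X) (Fin.succ i)) ∂(Measure.pi fun _ => μ)))
    (a b' : ℕ) :
    ∃ (ι : Type) (lam : ι → ℝ) (i₀ : ι), (∀ i, 0 ≤ lam i ∧ lam i ≤ lam i₀) ∧
      (∀ m : ℕ, HasSum (fun i => lam i ^ (m + 2))
        (∫ V : Fin (m + 2) → X, ∏ t, K (V t) (V (t + 1)) ∂(Measure.pi fun _ => μ))) ∧
      ∀ θ R : ℝ, 0 ≤ θ → 0 ≤ R → R ≤ 1 → 0 < lam i₀ → (∀ i, i ≠ i₀ → lam i ≤ θ * lam i₀) →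
        ∑' i, (lam i / lam i₀) ^ (b' + 2) ≤ 1 + R →
        |(∫ V : Fin (1 + (a + 2 + (b' + 1 + 1)) + 1) → X, ∏ t : Fin (1 + (a + 2 + (b' + 1 + 1)) + 1),
              (fun s : ℕ => if s = 0 then Xa else if s = a + 2 + 1 then Xb else K) (t : ℕ) (V t) (V (t + 1))
              ∂(Measure.pi fun _ => μ)) /
            (∫ V : Fin (2 * r + a + b' + 4 + 2) → X, ∏ t, K (V t) (V (t + 1)) ∂(Measure.pi fun _ => μ)) -
          (∫ V : Fin (1 + (r + a + b' + 3 + 1) + 1) → X, Xa (V 0) (V 1) *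
                ∏ t : Fin (1 + (r + a + b' + 3 + 1)), K (V t.succ) (V (t.succ + 1)) ∂(Measure.pi fun _ => μ)) /
              (∫ V : Fin (2 * r + a + b' + 4 + 2) → X, ∏ t, K (V t) (V (t + 1)) ∂(Measure.pi fun _ => μ)) *
            ((∫ V : Fin (1 + (r + a + b' + 3 + 1) + 1) → X, Xb (V 0) (V 1) *
                ∏ t : Fin (1 + (r + a + b' + 3 + 1)), K (V t.succ) (V (t.succ + 1)) ∂(Measure.pi fun _ => μ)) /
              (∫ V : Fin (2 * r + a + b' + 4 + 2) → X, ∏ t, K (V t) (V (t + 1)) ∂(Measure.pi fun _ => μ)))| ≤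
          2 * θ ^ (a + 2) + 6 * R := by
  -- a point of `X`, signs
  obtain ⟨x₀, -⟩ := nonempty_of_measure_ne_zero (μ := μ) (s := univ) (by rw [measure_univ]; exact one_ne_zero)
  have hC0 : 0 ≤ C := (norm_nonneg _).trans (hC x₀ x₀)
  -- the transfer operator and a countable eigenbasis
  obtain ⟨A, hA⟩ := exists_kernelOp (μ := μ) hK hC
  have hsa := isSelfAdjoint_kernelOp hK hC hsymm hA
  have hcpt := isCompactOperator_kernelOp hC hC0 hA
  obtain ⟨s, b, lam, hbs, hb0⟩ := exists_hilbertBasis_eigenvectors_of_isSelfAdjoint hcpt hsa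
  have hb : ∀ i, A (b i) = lam i • b i := fun i => by simpa using hb0 i
  haveI : Fact ((2 : ℝ≥0∞) ≠ ⊤) := ⟨ENNReal.ofNat_ne_top⟩
  have hon : Orthonormal ℝ ((↑) : s → Lp ℝ 2 μ) := hbs ▸ b.orthonormal
  haveI : Countable s := (hon.countable_of_separableSpace (𝕜 := ℝ)).to_subtype
  -- non-negative eigenvalues (positive type), square summability, a maximal eigenvalue
  have hlam0 : ∀ i, 0 ≤ lam i := fun i => by
    rw [lam_eq_inner hb i]; exact inner_kernelOp_self_nonneg hA hpt _
  have hS := hasSum_lam_sq hK hC hA hb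
  haveI : Nonempty s := nonempty_index_hilbertBasis_Lp b
  obtain ⟨i₀, hle⟩ := exists_forall_le_of_summable_sq hlam0 hS.summable
  -- the vacuum trace formulas
  have h6 : ∀ m : ℕ, HasSum (fun i => lam i ^ (m + 2))
      (∫ V : Fin (m + 2) → X, ∏ t, K (V t) (V (t + 1)) ∂(Measure.pi fun _ => μ)) := fun m =>
    hasSum_pow_integral_cyclic hK hC hsymm hA hb hlam0 m
  refine ⟨s, lam, i₀, fun i => ⟨hlam0 i, hle i⟩, h6, ?_⟩
  intro θ R hθ0 hR0 hR1 hL hθ hRb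
  -- the bond operators; `‖A‖ ≤ λ_{i₀}`, kernel domination `‖𝒳‖ ≤ λ_{i₀}^{r+1}`
  obtain ⟨Aop, hAop⟩ := exists_kernelOp (μ := μ) hXa hCXa
  obtain ⟨Bop, hBop⟩ := exists_kernelOp (μ := μ) hXb hCXb
  have hnormA : ‖A‖ ≤ lam i₀ :=
    norm_le_of_eigenbasis b hsa hb (hlam0 i₀) fun i => by rw [abs_of_nonneg (hlam0 i)]; exact hle i
  have hnA : ‖Aop‖ ≤ lam i₀ ^ (r + 1) := by
    have h := norm_kernelOp_le_of_abs_le_pathKernel hK hC hA hAop r zero_le_one hdomA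
    rw [one_mul] at h
    exact h.trans (pow_le_pow_left₀ (norm_nonneg _) hnormA _)
  have hnB : ‖Bop‖ ≤ lam i₀ ^ (r + 1) := by
    have h := norm_kernelOp_le_of_abs_le_pathKernel hK hC hA hBop r zero_le_one hdomB
    rw [one_mul] at h
    exact h.trans (pow_le_pow_left₀ (norm_nonneg _) hnormA _)
  -- the insertion trace formulas
  have hmXa : ∀ x y, ‖Xa x y‖ ≤ max CX C := fun x y => (hCXa x y).trans (le_max_left _ _)
  have hmXb : ∀ x y, ‖Xb x y‖ ≤ max CX C := fun x y => (hCXb x y).trans (le_max_left _ _)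
  have hmK : ∀ x y, ‖K x y‖ ≤ max CX C := fun x y => (hC x y).trans (le_max_right _ _)
  have h7 : HasSum (fun pr : s × s => lam pr.2 ^ (a + 2) * lam pr.1 ^ (b' + 2) *
        ⟪b pr.1, Aop (b pr.2)⟫ * ⟪b pr.2, Bop (b pr.1)⟫)
      (∫ V : Fin (1 + (a + 2 + (b' + 1 + 1)) + 1) → X, ∏ t : Fin (1 + (a + 2 + (b' + 1 + 1)) + 1),
        (fun s : ℕ => if s = 0 then Xa else if s = a + 2 + 1 then Xb else K) (t : ℕ) (V t) (V (t + 1))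
        ∂(Measure.pi fun _ => μ)) := by
    have hc2 := integral_cyclic_insert_two (ρ := μ) (X := Xa) (X' := Xb) (K := K) hXa.measurable hXb.measurable
      hK.measurable hmXa hmXb hmK (a + 2) (b' + 1)
    have h := hasSum_integral_iterate_insert_two hK hC hsymm hA hb hXa hCXa hAop hXb hCXb hBop a b'
    rw [← hc2] at h
    exact h
  have h8 : ∀ {Xk : X → X → ℝ} {Xop : Lp ℝ 2 μ →L[ℝ] Lp ℝ 2 μ}, StronglyMeasurable (uncurry Xk) →
      (∀ u u', ‖Xk u u'‖ ≤ CX) → (∀ φ : Lp ℝ 2 μ, (Xop φ : X → ℝ) =ᵐ[μ] fun x => ∫ y, Xk x y * φ y ∂μ) →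
      HasSum (fun i => lam i ^ (a + 2 + (b' + 2) + (r + 1)) * ⟪b i, Xop (b i)⟫)
        (∫ V : Fin (1 + (r + a + b' + 3 + 1) + 1) → X, Xk (V 0) (V 1) *
          ∏ t : Fin (1 + (r + a + b' + 3 + 1)), K (V t.succ) (V (t.succ + 1)) ∂(Measure.pi fun _ => μ)) := by
    intro Xk Xop hXk hCXk hXop
    have hmXk : ∀ x y, ‖Xk x y‖ ≤ max CX C := fun x y => (hCXk x y).trans (le_max_left _ _)
    have hc1 := integral_cyclic_insert_one (ρ := μ) (X := Xk) (K := K) hXk.measurable hK.measurable hmXk hmK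
      (r + a + b' + 3 + 1)
    have h9 := hasSum_integral_iterate_insert_one hK hC hsymm hA hb hXk hCXk hXop (r + a + b' + 3)
    rw [← hc1] at h9
    have e1 : r + a + b' + 3 + 2 = a + 2 + (b' + 2) + (r + 1) := by omega
    rw [e1] at h9
    exact h9
  have h8a := h8 hXa hCXa hAop
  have h8b := h8 hXb hCXb hBop
  have e2 : 2 * r + a + b' + 4 + 2 = a + 2 + (b' + 2) + 2 * (r + 1) := by omega
  have hZ : HasSum (fun i => lam i ^ (a + 2 + (b' + 2) + 2 * (r + 1)))
      (∫ V : Fin (2 * r + a + b' + 4 + 2) → X, ∏ t, K (V t) (V (t + 1)) ∂(Measure.pi fun _ => μ)) := by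
    rw [← e2]; exact h6 (2 * r + a + b' + 4)
  -- summability of the normalised long-arc powers
  have hsb : Summable fun i => (lam i / lam i₀) ^ (b' + 2) := by
    have h1 : Summable fun i => lam i ^ 2 / lam i₀ ^ 2 := hS.summable.div_const _
    refine h1.of_nonneg_of_le (fun i => pow_nonneg (div_nonneg (hlam0 i) hL.le) _) fun i => ?_
    have hρ1 : lam i / lam i₀ ≤ 1 := div_le_one_of_le₀ (hle i) hL.le
    calc (lam i / lam i₀) ^ (b' + 2) ≤ (lam i / lam i₀) ^ 2 :=
          pow_le_pow_of_le_one (div_nonneg (hlam0 i) hL.le) hρ1 (by omega)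
      _ = lam i ^ 2 / lam i₀ ^ 2 := div_pow _ _ _
  -- matrix element bounds
  have hd₁ : ∀ i, |⟪b i, Aop (b i)⟫| ≤ lam i₀ ^ (r + 1) := fun i => (abs_inner_apply_basis_le b Aop i).trans hnA
  have hd₂ : ∀ i, |⟪b i, Bop (b i)⟫| ≤ lam i₀ ^ (r + 1) := fun i => (abs_inner_apply_basis_le b Bop i).trans hnB
  have hrow : ∀ i, Summable (fun j => |⟪b i, Aop (b j)⟫| * |⟪b j, Bop (b i)⟫|) ∧
      ∑' j, |⟪b i, Aop (b j)⟫| * |⟪b j, Bop (b i)⟫| ≤ (lam i₀ ^ (r + 1)) ^ 2 := fun i => by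
    obtain ⟨hs1, hle1⟩ := tsum_abs_matrix_row_le b Aop Bop i
    refine ⟨hs1, hle1.trans ?_⟩
    rw [sq]
    exact mul_le_mul hnA hnB (norm_nonneg _) (pow_nonneg hL.le _)
  exact eigenbasis_cov_bound (M₁ := fun i j => ⟪b i, Aop (b j)⟫) (M₂ := fun i j => ⟪b i, Bop (b j)⟫) hlam0 hle hL hθ0
    hθ hR0 hR1 hsb hRb hd₁ hd₂ hrow h7 h8a h8b hZ

end Literature.Analysis.OperatorTheory

end
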